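import Mathlib
import Literature.NumberTheory.Transcendental.KZCalculusProofs

/-!
# `OffTetraSectorKernel` (stmt-KontsevichZagierPeriods-10557), line `odd-hyperbolic-ladder`:
# bounded shadow and floor clearance of a finite-volume polytope (rung 2)

Stub `stub_floorClearance`. Rung 2 of the hyperbolic scissors ladder consists of the volumes of
finite-volume `ℚ̄`-geodesic polytopes of hyperbolic 3-space (upper half-space model,
`p : Fin 3 → ℝ`, horizontal part `q = (p 0, p 1)`, height `t = p 2 > 0`, volume density `t⁻³`),
written in NORMAL FORM `P = {0 < t} ∩ ⋂ᵢ {0 < L i • Ql p}` through the paraboloid lift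
`Ql p = (|p|², p 0, p 1, 1)`: the constraint `i` equals `gᵢ(q) + L i 0 * t²` with the FLOOR TRACE
`gᵢ(n) = L i 0 * |n|² + L i 1 * n₀ + L i 2 * n₁ + L i 3`.

Hypotheses: `P` is nonempty, every constraint is negative somewhere in the upper half-space,
`t⁻³` is integrable on `P`, and FLOOR DIVERGENCE (`stub_floorDivergence`, a hypothesis here): if
at a floor point at most one trace vanishes (then with non-zero gradient) and the others are
positive, `t⁻³` is not integrable on `P`.

Conclusions.
* (a) BOUNDED SHADOW. An "inside hemisphere" constraint (`L i 0 < 0`) bounds `|q|` directly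
  (`0 < gᵢ(q) + L i 0 t² ≤ gᵢ(q)`, a downward paraboloid); otherwise all `L i 0 ≥ 0`, and a point
  of `P` with `|q|` beyond the radius past which every round trace is positive is a floor point
  with all traces positive — floor divergence contradicts finite volume.
* (b) FLOOR CLEARANCE. For `η > 0` there is `δ > 0` such that every point of `P` below height `δ`
  is within `η` of a FLOOR CANDIDATE (a point where two traces of different constraints vanish):
  otherwise pick `p_m ∈ P` with `t_m < 1/(m+1)` and no candidate within `η`; by (a) and
  Bolzano–Weierstrass a subsequence converges to a floor point `p*` (`t* = 0`) at which every
  trace is `≥ 0`; two vanishing traces make `p*` a candidate close to some `p_m` (contradiction),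
  and otherwise floor divergence applies at `p*` (a vanishing trace with vanishing gradient would
  make the constraint `L i 0 (|q - q*|² + t²)`, of constant sign on the upper half-space,
  contradicting nonemptiness or the negativity hypothesis) — contradiction with finite volume.

References: M. Kontsevich, D. Zagier, *Periods* (2001), §1.2.
-/

noncomputable section

open Set MeasureTheory Filter Topology
open Literature.NumberTheory.Transcendental

namespace Summit.KontsevichZagierPeriods.HyperbolicBloch.OffTetraSectorKernel

/-- GROWTH: a positive multiple of `x² + y²` dominates any affine function outside a large disc,
`|C₁ x + C₂ y + D| < a (x² + y²)` for `x² + y² ≥ M²`. [folklore] -/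
theorem clear_lin_lt_quad {a : ℝ} (ha : 0 < a) (C₁ C₂ D : ℝ) :
    ∃ M : ℝ, 0 < M ∧ ∀ x y : ℝ, M ^ 2 ≤ x ^ 2 + y ^ 2 →
      |C₁ * x + C₂ * y + D| < a * (x ^ 2 + y ^ 2) := by
  refine ⟨(|C₁| + |C₂| + |D|) / a + 1, by positivity, fun x y hM => ?_⟩
  obtain ⟨r, hr⟩ : ∃ r : ℝ, r = Real.sqrt (x ^ 2 + y ^ 2) := ⟨_, rfl⟩
  have hr0 : 0 ≤ r := hr ▸ Real.sqrt_nonneg _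
  have hr2 : r ^ 2 = x ^ 2 + y ^ 2 := hr ▸ Real.sq_sqrt (by positivity)
  have hx : |x| ≤ r := hr ▸ Real.abs_le_sqrt (by nlinarith [sq_nonneg y])
  have hy : |y| ≤ r := hr ▸ Real.abs_le_sqrt (by nlinarith [sq_nonneg x])
  have hMr : (|C₁| + |C₂| + |D|) / a + 1 ≤ r := le_of_sq_le_sq (hr2 ▸ hM) hr0
  have hK0 : 0 ≤ (|C₁| + |C₂| + |D|) / a := by positivity
  have h1 : 1 ≤ r := le_trans (by linarith) hMr
  have hK : a * ((|C₁| + |C₂| + |D|) / a + 1) = |C₁| + |C₂| + |D| + a := by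
    field_simp
  have hKr : |C₁| + |C₂| + |D| < a * r := by
    have := mul_le_mul_of_nonneg_left hMr ha.le
    linarith
  calc |C₁ * x + C₂ * y + D| ≤ |C₁| * |x| + |C₂| * |y| + |D| := by
        calc |C₁ * x + C₂ * y + D| ≤ |C₁ * x + C₂ * y| + |D| := abs_add_le _ _
          _ ≤ |C₁ * x| + |C₂ * y| + |D| := by gcongr; exact abs_add_le _ _
          _ = |C₁| * |x| + |C₂| * |y| + |D| := by rw [abs_mul, abs_mul]
    _ ≤ (|C₁| + |C₂| + |D|) * r := by
        nlinarith [abs_nonneg C₁, abs_nonneg C₂, abs_nonneg D]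
    _ < a * r * r := by nlinarith
    _ = a * (x ^ 2 + y ^ 2) := by rw [← hr2]; ring

/-- BOUNDED SHADOW (conclusion (a)), abstract form: if every point of `P` satisfies all the 3-D
constraints `0 < L i 0 (|q|² + t²) + L i 1 q₀ + L i 2 q₁ + L i 3` and no floor point has all
traces positive (floor divergence against finite volume), then the horizontal shadow of `P` is
bounded: an inside-hemisphere constraint `L i 0 < 0` bounds it directly, and otherwise a far point
of `P` would be a floor point with all traces positive. [folklore] -/
theorem clear_shadow_bounded {k : ℕ} (L : Fin k → Fin 4 → ℝ) (P : Set (Fin 3 → ℝ))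
    (hP : ∀ p ∈ P, 0 < p 2 ∧ ∀ i,
      0 < L i 0 * (p 0 ^ 2 + p 1 ^ 2 + p 2 ^ 2) + L i 1 * p 0 + L i 2 * p 1 + L i 3)
    (hDiv : ∀ n : Fin 2 → ℝ,
      (∀ i, 0 < L i 0 * (n 0 ^ 2 + n 1 ^ 2) + L i 1 * n 0 + L i 2 * n 1 + L i 3) → False) :
    ∃ M : ℝ, ∀ p ∈ P, p 0 ^ 2 + p 1 ^ 2 < M ^ 2 := by
  by_cases hneg : ∃ i, L i 0 < 0
  · obtain ⟨i, hi⟩ := hneg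
    obtain ⟨M, -, hM⟩ := clear_lin_lt_quad (neg_pos.2 hi) (L i 1) (L i 2) (L i 3)
    refine ⟨M, fun p hp => ?_⟩
    by_contra hlt
    have h1 := hM (p 0) (p 1) (not_lt.1 hlt)
    have h2 := (hP p hp).2 i
    have h3 : L i 0 * p 2 ^ 2 ≤ 0 := mul_nonpos_of_nonpos_of_nonneg hi.le (sq_nonneg _)
    have h4 := le_abs_self (L i 1 * p 0 + L i 2 * p 1 + L i 3)
    linarith
  · push Not at hneg
    have hR : ∀ i, ∃ R : ℝ, 0 < R ∧ (0 < L i 0 → ∀ x y : ℝ, R ^ 2 ≤ x ^ 2 + y ^ 2 →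
        0 < L i 0 * (x ^ 2 + y ^ 2) + L i 1 * x + L i 2 * y + L i 3) := by
      intro i
      rcases (hneg i).lt_or_eq with hpos | hzero
      · obtain ⟨M, hM0, hM⟩ := clear_lin_lt_quad hpos (L i 1) (L i 2) (L i 3)
        refine ⟨M, hM0, fun _ x y hxy => ?_⟩
        have h1 := hM x y hxy
        have h2 := neg_abs_le (L i 1 * x + L i 2 * y + L i 3)
        linarith
      · exact ⟨1, one_pos, fun h => absurd h (by rw [← hzero]; exact lt_irrefl 0)⟩
    choose R hR0 hR using hR
    obtain ⟨S, hS⟩ := Finite.exists_le R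
    by_contra hunb
    push Not at hunb
    obtain ⟨p, hp, hpS⟩ := hunb S
    refine hDiv ![p 0, p 1] fun i => ?_
    simp only [Matrix.cons_val_zero, Matrix.cons_val_one, Matrix.cons_val_fin_one]
    rcases (hneg i).lt_or_eq with hpos | hzero
    · exact hR i hpos (p 0) (p 1) (le_trans (pow_le_pow_left₀ (hR0 i).le (hS i) 2) hpS)
    · have := (hP p hp).2 i
      rw [← hzero] at this ⊢
      nlinarith [sq_nonneg (p 2)]

/-- DEGENERATE TRACE: if the floor trace of constraint `i` vanishes at `n` together with its
gradient, the 3-D constraint is `L i 0 (|q - n|² + t²)` identically. [folklore] -/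
theorem clear_degenerate {k : ℕ} (L : Fin k → Fin 4 → ℝ) (i : Fin k) (n : Fin 2 → ℝ)
    (htr : L i 0 * (n 0 ^ 2 + n 1 ^ 2) + L i 1 * n 0 + L i 2 * n 1 + L i 3 = 0)
    (hg0 : 2 * L i 0 * n 0 + L i 1 = 0) (hg1 : 2 * L i 0 * n 1 + L i 2 = 0) (p : Fin 3 → ℝ) :
    L i 0 * (p 0 ^ 2 + p 1 ^ 2 + p 2 ^ 2) + L i 1 * p 0 + L i 2 * p 1 + L i 3 =
      L i 0 * ((p 0 - n 0) ^ 2 + (p 1 - n 1) ^ 2 + p 2 ^ 2) := by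
  linear_combination htr + (p 0 - n 0) * hg0 + (p 1 - n 1) * hg1

/-- NON-ZERO GRADIENT AT A SIMPLE FLOOR ZERO: if the trace of constraint `i` vanishes at `n`, the
constraint is positive at some point and negative at some point of the upper half-space, then the
gradient of the trace at `n` is non-zero (otherwise the constraint is `L i 0 (|q - n|² + t²)`, of
constant sign on `t > 0`). [folklore] -/
theorem clear_grad_ne_zero {k : ℕ} (L : Fin k → Fin 4 → ℝ) (i : Fin k) (n : Fin 2 → ℝ)
    (htr : L i 0 * (n 0 ^ 2 + n 1 ^ 2) + L i 1 * n 0 + L i 2 * n 1 + L i 3 = 0)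
    (hpos : ∃ p : Fin 3 → ℝ, 0 < p 2 ∧
      0 < L i 0 * (p 0 ^ 2 + p 1 ^ 2 + p 2 ^ 2) + L i 1 * p 0 + L i 2 * p 1 + L i 3)
    (hneg : ∃ p : Fin 3 → ℝ, 0 < p 2 ∧
      L i 0 * (p 0 ^ 2 + p 1 ^ 2 + p 2 ^ 2) + L i 1 * p 0 + L i 2 * p 1 + L i 3 < 0) :
    2 * L i 0 * n 0 + L i 1 ≠ 0 ∨ 2 * L i 0 * n 1 + L i 2 ≠ 0 := by
  by_contra h
  push Not at h
  obtain ⟨hg0, hg1⟩ := h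
  obtain ⟨p, hp2, hp⟩ := hpos
  obtain ⟨q, hq2, hq⟩ := hneg
  rw [clear_degenerate L i n htr hg0 hg1] at hp hq
  have hXp : 0 < (p 0 - n 0) ^ 2 + (p 1 - n 1) ^ 2 + p 2 ^ 2 := by positivity
  have hXq : 0 < (q 0 - n 0) ^ 2 + (q 1 - n 1) ^ 2 + q 2 ^ 2 := by positivity
  rcases le_or_gt (L i 0) 0 with h0 | h0
  · exact absurd hp (not_lt.2 (mul_nonpos_of_nonpos_of_nonneg h0 hXp.le))
  · exact absurd hq (not_lt.2 (mul_pos h0 hXq).le)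

/-- BOLZANO–WEIERSTRASS in `Fin 3 → ℝ` (sup norm): a coordinatewise bounded sequence has a
convergent subsequence. [folklore] -/
theorem clear_subseq (p : ℕ → Fin 3 → ℝ) (R : ℝ) (hR : ∀ m b, |p m b| ≤ R) :
    ∃ (pstar : Fin 3 → ℝ) (φ : ℕ → ℕ), StrictMono φ ∧
      Tendsto (fun m => p (φ m)) atTop (𝓝 pstar) := by
  have hR0 : 0 ≤ R := le_trans (abs_nonneg _) (hR 0 0)
  have hmem : ∀ m, p m ∈ Metric.closedBall (0 : Fin 3 → ℝ) R := fun m =>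
    mem_closedBall_zero_iff.2 ((pi_norm_le_iff_of_nonneg hR0).2 fun b => by
      rw [Real.norm_eq_abs]; exact hR m b)
  obtain ⟨pstar, -, φ, hφ, hlim⟩ :=
    (isCompact_closedBall (0 : Fin 3 → ℝ) R).tendsto_subseq hmem
  exact ⟨pstar, φ, hφ, hlim⟩

/-- STUB `stub_floorClearance` (v5; consumes `stub_floorDivergence` as a hypothesis): a
finite-volume normal-form polytope has (a) bounded shadow (a far point of an unbounded polytope
without inside-hemisphere constraint is a floor point with all traces positive) and (b) FLOOR
CLEARANCE: below height `δ(η)` every point lies within `η` of a floor candidate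
(Bolzano–Weierstrass on the bounded shadow + floor divergence at the limit point). [folklore] -/
theorem stub_floorClearance :
    ∀ (Ql : (Fin 3 → ℝ) → Fin 4 → ℝ), (∀ p, Ql p = ![p 0 ^ 2 + p 1 ^ 2 + p 2 ^ 2, p 0, p 1, 1]) →
    (∀ (k : ℕ) (L : Fin k → Fin 4 → ℝ) (P : Set (Fin 3 → ℝ)),
      P = {p | 0 < p 2 ∧ ∀ i, 0 < ∑ c, L i c * Ql p c} →
      ∀ (n : Fin 2 → ℝ),
      (∀ i, 0 < L i 0 * (n 0 ^ 2 + n 1 ^ 2) + L i 1 * n 0 + L i 2 * n 1 + L i 3 ∨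
        (L i 0 * (n 0 ^ 2 + n 1 ^ 2) + L i 1 * n 0 + L i 2 * n 1 + L i 3 = 0 ∧
          (2 * L i 0 * n 0 + L i 1 ≠ 0 ∨ 2 * L i 0 * n 1 + L i 2 ≠ 0) ∧
          ∀ j, j ≠ i → 0 < L j 0 * (n 0 ^ 2 + n 1 ^ 2) + L j 1 * n 0 + L j 2 * n 1 + L j 3)) →
      ¬ IntegrableOn (fun p : Fin 3 → ℝ => 1 / p 2 ^ 3) P) →
    ∀ (k : ℕ) (L : Fin k → Fin 4 → ℝ) (P : Set (Fin 3 → ℝ)),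
      P = {p | 0 < p 2 ∧ ∀ i, 0 < ∑ c, L i c * Ql p c} → P.Nonempty →
      (∀ i, ∃ p : Fin 3 → ℝ, 0 < p 2 ∧ ∑ c, L i c * Ql p c < 0) →
      IntegrableOn (fun p : Fin 3 → ℝ => 1 / p 2 ^ 3) P →
      (∃ M : ℝ, ∀ p ∈ P, p 0 ^ 2 + p 1 ^ 2 < M ^ 2) ∧
      (∀ η : ℝ, 0 < η → ∃ δ : ℝ, 0 < δ ∧ ∀ p ∈ P, p 2 < δ → ∃ n : Fin 2 → ℝ,
        (∃ i j, i ≠ j ∧ L i 0 * (n 0 ^ 2 + n 1 ^ 2) + L i 1 * n 0 + L i 2 * n 1 + L i 3 = 0 ∧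
            L j 0 * (n 0 ^ 2 + n 1 ^ 2) + L j 1 * n 0 + L j 2 * n 1 + L j 3 = 0) ∧
        (p 0 - n 0) ^ 2 + (p 1 - n 1) ^ 2 < η ^ 2) := by
  intro Ql hQl hDiv k L P hP hne hND hint
  have hF : ∀ i (p : Fin 3 → ℝ), ∑ c, L i c * Ql p c =
      L i 0 * (p 0 ^ 2 + p 1 ^ 2 + p 2 ^ 2) + L i 1 * p 0 + L i 2 * p 1 + L i 3 := by
    intro i p
    rw [hQl, Fin.sum_univ_four]
    simp
  have hmem : ∀ p, p ∈ P ↔ 0 < p 2 ∧ ∀ i,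
      0 < L i 0 * (p 0 ^ 2 + p 1 ^ 2 + p 2 ^ 2) + L i 1 * p 0 + L i 2 * p 1 + L i 3 := by
    intro p
    rw [hP]
    simp only [mem_setOf_eq, hF]
  have hDiv' := hDiv k L P hP
  have hbound : ∃ M : ℝ, ∀ p ∈ P, p 0 ^ 2 + p 1 ^ 2 < M ^ 2 :=
    clear_shadow_bounded L P (fun p hp => (hmem p).1 hp)
      (fun n hn => hDiv' n (fun i => Or.inl (hn i)) hint)
  refine ⟨hbound, fun η hη => ?_⟩
  obtain ⟨M, hM⟩ := hbound
  by_contra hcon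
  push Not at hcon
  choose p hpP hpδ hfar using fun m : ℕ => hcon (1 / ((m : ℝ) + 1)) (by positivity)
  -- a convergent subsequence `p (φ m) → pstar`
  obtain ⟨pstar, φ, hφ, hlim⟩ := clear_subseq p (max |M| 1) (by
    intro m b
    have hq := hM (p m) (hpP m)
    have ht := ((hmem _).1 (hpP m)).1
    have hδ := hpδ m
    have hδ1 : 1 / ((m : ℝ) + 1) ≤ 1 := by
      rw [div_le_one (by positivity)]
      linarith [(Nat.cast_nonneg m : (0 : ℝ) ≤ m)]
    have H0 : |p m 0| ≤ max |M| 1 :=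
      le_trans (sq_le_sq.1 (by nlinarith [sq_nonneg (p m 1)])) (le_max_left _ _)
    have H1 : |p m 1| ≤ max |M| 1 :=
      le_trans (sq_le_sq.1 (by nlinarith [sq_nonneg (p m 0)])) (le_max_left _ _)
    have H2 : |p m 2| ≤ max |M| 1 :=
      le_trans (by rw [abs_of_pos ht]; linarith) (le_max_right _ _)
    fin_cases b
    · simpa using H0
    · simpa using H1
    · simpa using H2)
  -- the limit point lies on the floor
  have h2 : pstar 2 = 0 := by
    have hA : Tendsto (fun m => p (φ m) 2) atTop (𝓝 (pstar 2)) :=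
      ((continuous_apply 2).tendsto pstar).comp hlim
    have hB : Tendsto (fun m => p (φ m) 2) atTop (𝓝 0) := by
      refine squeeze_zero (fun m => ((hmem _).1 (hpP _)).1.le) (fun m => ?_)
        tendsto_one_div_add_atTop_nhds_zero_nat
      refine (hpδ (φ m)).le.trans ?_
      gcongr
      exact_mod_cast hφ.le_apply
    exact tendsto_nhds_unique hA hB
  -- its horizontal part `nstar`; every trace is `≥ 0` there
  obtain ⟨nstar, hnstar⟩ : ∃ n : Fin 2 → ℝ, n = ![pstar 0, pstar 1] := ⟨_, rfl⟩
  have hn0 : nstar 0 = pstar 0 := by rw [hnstar]; rfl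
  have hn1 : nstar 1 = pstar 1 := by rw [hnstar]; rfl
  have htr : ∀ i, 0 ≤ L i 0 * (nstar 0 ^ 2 + nstar 1 ^ 2) + L i 1 * nstar 0 +
      L i 2 * nstar 1 + L i 3 := by
    intro i
    have hc : Continuous fun p : Fin 3 → ℝ =>
        L i 0 * (p 0 ^ 2 + p 1 ^ 2 + p 2 ^ 2) + L i 1 * p 0 + L i 2 * p 1 + L i 3 := by
      fun_prop
    have hge := ge_of_tendsto' ((hc.tendsto pstar).comp hlim)
      (fun m => (((hmem _).1 (hpP (φ m))).2 i).le)
    rw [h2] at hge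
    rw [hn0, hn1]
    linarith
  by_cases htwo : ∃ i j, i ≠ j ∧
      L i 0 * (nstar 0 ^ 2 + nstar 1 ^ 2) + L i 1 * nstar 0 + L i 2 * nstar 1 + L i 3 = 0 ∧
      L j 0 * (nstar 0 ^ 2 + nstar 1 ^ 2) + L j 1 * nstar 0 + L j 2 * nstar 1 + L j 3 = 0
  · -- `nstar` is a floor candidate, and `p (φ N)` is within `η` of it
    obtain ⟨N, hN⟩ := Metric.tendsto_atTop.1 hlim (η / 2) (by positivity)
    have hd := hN N le_rfl
    have h0 : |p (φ N) 0 - pstar 0| < η / 2 := by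
      have := dist_le_pi_dist (p (φ N)) pstar 0
      rw [Real.dist_eq] at this
      linarith
    have h1 : |p (φ N) 1 - pstar 1| < η / 2 := by
      have := dist_le_pi_dist (p (φ N)) pstar 1
      rw [Real.dist_eq] at this
      linarith
    have hfarN := hfar (φ N) nstar htwo
    rw [hn0, hn1] at hfarN
    nlinarith [abs_lt.1 h0, abs_lt.1 h1, sq_abs (p (φ N) 0 - pstar 0),
      sq_abs (p (φ N) 1 - pstar 1)]
  · -- at most one trace vanishes at `nstar`: floor divergence applies
    push Not at htwo
    refine hDiv' nstar (fun i => ?_) hint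
    rcases (htr i).lt_or_eq with hpos | hzero
    · exact Or.inl hpos
    · refine Or.inr ⟨hzero.symm, ?_, fun j hji => ?_⟩
      · obtain ⟨p₀, hp₀⟩ := hne
        have hp₀' := (hmem p₀).1 hp₀
        obtain ⟨q, hq2, hq⟩ := hND i
        rw [hF] at hq
        exact clear_grad_ne_zero L i nstar hzero.symm ⟨p₀, hp₀'.1, hp₀'.2 i⟩ ⟨q, hq2, hq⟩
      · rcases (htr j).lt_or_eq with hposj | hzeroj
        · exact hposj
        · exact absurd hzeroj.symm (htwo i j (Ne.symm hji) hzero.symm)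

end Summit.KontsevichZagierPeriods.HyperbolicBloch.OffTetraSectorKernel
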